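import Summits.KontsevichZagierPeriods.KontsevichZagierPeriods.Theses.ToricCore
import Literature.NumberTheory.Transcendental.KZToricCalculus
import Literature.NumberTheory.Transcendental.GenusZeroPeriodsMZVProofs
import Summits.KontsevichZagierPeriods.KontsevichZagierPeriods.Theorems.InverseLandauTateLiftingSimplexValue

/-!
# `CubicalCoordinates` (stmt-KontsevichZagierPeriods-7839, route ToricCore) — proof

For an admissible index `s` of weight `w` and any representation `r` on the open cube `□ʷ` whose
integrand agrees there with `mzvIntegrand s (x₀, x₀x₁, …, x₀⋯x_{w-1}) · ∏ⱼ xⱼ^{w-1-j}`, the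
difference `[mzvRep s] − [r]` lies in the toric sub-calculus `R_tor` (token for token the
Literature constant `KZ.toricRelations`).

Proof: ONE monomial move. The cubical chart `Φ(x)ᵢ = ∏_{j ≤ i} xⱼ` of the ordered simplex
(`Hyperlog.φc`) is the integer monomial map of the unimodular lower-triangular `0/1` matrix
`A i j = [j ≤ i]` (`det A = 1`); it carries the open cube onto the open ordered simplex
(`Hyperlog.φc_image`), and its toric Jacobian factor `|det A| · ∏ᵢ Φ(x)ᵢ / ∏ⱼ xⱼ` is
`∏ⱼ xⱼ^{w-1-j}` (`∏ᵢ Φ(x)ᵢ = ∏ⱼ xⱼ · ∏ᵢ ∏_{k<i} x_k`). Both representations are toric AS DATA: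
the cube is the signed-binomial cell `{xᵢ > 0, 1 − xᵢ > 0}` and its integrand is the monomial
`∏ⱼ xⱼ^{w-1-j}` divided by the signed binomials `x₀⋯xᵢ` resp. `1 − x₀⋯xᵢ`; the simplex is the
cell `{tᵢ > 0, 1 − tᵢ > 0, tᵢ − tⱼ > 0 (i < j)}` and `∏ ω_ε(tᵢ) = 1 / ∏ (tᵢ resp. 1 − tᵢ)`. Hence
`[r] − [mzvRep s]` is a generator of `R_tor` (`KZ.sub_mem_toricRelations_of_monomial`) and its
negative is the claim. (lead c10 of crux 9129, banking)
-/

open Set MeasureTheory MvPolynomial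
open Literature.NumberTheory.Transcendental

namespace Summit.KontsevichZagierPeriods.ToricCore

variable {n : ℕ}

/-! ### Signed binomials -/

/-- The monomial with exponent vector `Pi.single i 1` is the coordinate `xᵢ`. [folklore] -/
theorem prod_pow_single (x : Fin n → ℝ) (i : Fin n) :
    ∏ l, x l ^ (Pi.single i 1 : Fin n → ℕ) l = x i := by
  rw [Finset.prod_eq_single i (fun l _ hl => by simp [hl])
    (fun h => absurd (Finset.mem_univ i) h)]
  simp

/-- The monomial with the `0/1` exponent vector `[l ≤ i]` is the partial product `∏_{l ≤ i} x_l`,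
written as a product of `if`s. [folklore] -/
theorem prod_pow_ite_le (x : Fin n → ℝ) (i : Fin n) :
    ∏ l, x l ^ (if l ≤ i then 1 else 0 : ℕ) = ∏ l, if l ≤ i then x l else 1 :=
  Finset.prod_congr rfl fun l _ => by split_ifs <;> simp

/-- A coordinate function `x ↦ xᵢ` is a signed binomial (`1 · x^{eᵢ} + 0`). [folklore] -/
theorem isSignedBinomial_coord (i : Fin n) : KZ.IsSignedBinomial (fun x : Fin n → ℝ => x i) :=
  ⟨1, 0, Pi.single i 1, 0, funext fun x => by simp [prod_pow_single]⟩

/-- `x ↦ 1 − xᵢ` is a signed binomial (`1 · x⁰ + (−1) · x^{eᵢ}`). [folklore] -/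
theorem isSignedBinomial_one_sub_coord (i : Fin n) :
    KZ.IsSignedBinomial (fun x : Fin n → ℝ => 1 - x i) :=
  ⟨1, -1, 0, Pi.single i 1, funext fun x => by simp [prod_pow_single, sub_eq_add_neg]⟩

/-- `x ↦ xᵢ − xⱼ` is a signed binomial (`1 · x^{eᵢ} + (−1) · x^{eⱼ}`). [folklore] -/
theorem isSignedBinomial_coord_sub_coord (i j : Fin n) :
    KZ.IsSignedBinomial (fun x : Fin n → ℝ => x i - x j) :=
  ⟨1, -1, Pi.single i 1, Pi.single j 1, funext fun x => by
    simp [prod_pow_single, sub_eq_add_neg]⟩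

/-- The constant `1` is a signed binomial (`1 · x⁰ + 0`). [folklore] -/
theorem isSignedBinomial_one : KZ.IsSignedBinomial (fun _ : Fin n → ℝ => (1 : ℝ)) :=
  ⟨1, 0, 0, 0, funext fun x => by simp⟩

/-- The partial product `x ↦ ∏_{l ≤ i} x_l` (as a product of `if`s) is a signed binomial
(a monomial with `0/1` exponents). [folklore] -/
theorem isSignedBinomial_chart (i : Fin n) :
    KZ.IsSignedBinomial (fun x : Fin n → ℝ => ∏ l, if l ≤ i then x l else 1) :=
  ⟨1, 0, fun l => if l ≤ i then 1 else 0, 0, funext fun x => by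
    rw [prod_pow_ite_le]; simp⟩

/-- `x ↦ 1 − ∏_{l ≤ i} x_l` is a signed binomial. [folklore] -/
theorem isSignedBinomial_one_sub_chart (i : Fin n) :
    KZ.IsSignedBinomial (fun x : Fin n → ℝ => 1 - ∏ l, if l ≤ i then x l else 1) :=
  ⟨1, -1, 0, fun l => if l ≤ i then 1 else 0, funext fun x => by
    rw [prod_pow_ite_le]; simp [sub_eq_add_neg]⟩

/-! ### The letters `ω_ε` as reciprocals of signed binomials -/

/-- `∏ᵢ ω_{εᵢ}(uᵢ) = 1 / ∏ᵢ (1 − uᵢ resp. uᵢ)`: the MZV integrand is the reciprocal of a product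
of (images of) signed binomials. [cite: KontsevichZagier2001, §1.1] -/
theorem prod_mzvForm_eq_one_div {m : ℕ} (ε : Fin m → Bool) (u : Fin m → ℝ) :
    ∏ i, KZ.mzvForm (ε i) (u i) = 1 / ∏ i, (if ε i then 1 - u i else u i) := by
  have h : ∀ i, KZ.mzvForm (ε i) (u i) = 1 / (if ε i then 1 - u i else u i) := fun i => by
    unfold KZ.mzvForm
    split_ifs <;> rfl
  rw [Finset.prod_congr rfl fun i _ => h i, Finset.prod_div_distrib, Finset.prod_const_one]

/-! ### Toric data: the cube representation and the simplex representation -/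

/-- **The cubical form is toric as data.** A representation on the open cube `□ʷ` whose integrand
agrees there with `(∏ᵢ ω_{εᵢ}(x₀⋯xᵢ)) · ∏ⱼ xⱼ^{w-1-j}` is toric: the cube is the signed-binomial
cell `{xᵢ > 0, 1 − xᵢ > 0}` and the integrand is the monomial `∏ⱼ xⱼ^{w-1-j}` divided by the
signed binomials `x₀⋯xᵢ` resp. `1 − x₀⋯xᵢ`. [cite: GuoPaychaZhang2014, §2] -/
theorem isToric_of_cube {w : ℕ} (ε : Fin w → Bool) (r : KZ.IntegralRep w)
    (hdom : r.domain = {x | ∀ i, 0 < x i ∧ x i < 1})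
    (hint : EqOn r.integrand (fun x => (∏ i, KZ.mzvForm (ε i) (∏ j, if j ≤ i then x j else 1)) *
      ∏ j : Fin w, x j ^ (w - 1 - (j : ℕ))) r.domain) :
    KZ.IsToric r := by
  classical
  -- index the `2w` strict inequalities `xᵢ > 0`, `1 - xᵢ > 0` by `Fin w ⊕ Fin w`
  refine ⟨Fintype.card (Fin w ⊕ Fin w), 0, w,
    fun k => Sum.elim (fun (i : Fin w) (x : Fin w → ℝ) => x i) (fun i x => 1 - x i)
      ((Fintype.equivFin (Fin w ⊕ Fin w)).symm k),
    fun k => Fin.elim0 k,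
    fun k x => if ε k then 1 - ∏ j, (if j ≤ k then x j else 1) else ∏ j, (if j ≤ k then x j else 1),
    ∏ j : Fin w, (X j : MvPolynomial (Fin w) ℚ) ^ (w - 1 - (j : ℕ)), ?_, ?_, ?_⟩
  · rintro f ((⟨k, rfl⟩ | ⟨k, rfl⟩) | ⟨k, rfl⟩)
    · dsimp only
      generalize (Fintype.equivFin (Fin w ⊕ Fin w)).symm k = j
      rcases j with i | i
      · exact isSignedBinomial_coord i
      · exact isSignedBinomial_one_sub_coord i
    · exact k.elim0
    · by_cases hk : ε k
      · simp only [hk, if_true]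
        exact isSignedBinomial_one_sub_chart k
      · simp only [hk, Bool.false_eq_true, if_false]
        exact isSignedBinomial_chart k
  · rw [hdom]
    ext x
    simp only [mem_setOf_eq]
    constructor
    · intro hx
      refine ⟨fun k => ?_, fun k => k.elim0⟩
      generalize (Fintype.equivFin (Fin w ⊕ Fin w)).symm k = j
      rcases j with i | i
      · exact (hx i).1
      · exact sub_pos.mpr (hx i).2
    · rintro ⟨hg, -⟩ i
      have h1 := hg (Fintype.equivFin (Fin w ⊕ Fin w) (Sum.inl i))
      have h2 := hg (Fintype.equivFin (Fin w ⊕ Fin w) (Sum.inr i))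
      rw [Equiv.symm_apply_apply] at h1 h2
      exact ⟨h1, sub_pos.mp h2⟩
  · intro x hx
    rw [hint hx]
    dsimp only
    rw [prod_mzvForm_eq_one_div]
    simp only [map_prod, map_pow, aeval_X]
    rw [div_mul_eq_mul_div, one_mul]

/-- **The simplex form is toric as data.** A representation on the open ordered simplex
`{1 > t₀ > ⋯ > t_{w-1} > 0}` whose integrand agrees there with `∏ᵢ ω_{εᵢ}(tᵢ)` is toric: the
simplex is the signed-binomial cell `{tᵢ > 0, 1 − tᵢ > 0, tᵢ − tⱼ > 0 (i < j)}` (redundant pairs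
`i ≥ j` carry the constant binomial `1 > 0`) and `∏ᵢ ω_{εᵢ}(tᵢ) = 1 / ∏ᵢ (tᵢ resp. 1 − tᵢ)`.
[cite: GuoPaychaZhang2014, §2] -/
theorem isToric_of_simplex {w : ℕ} (ε : Fin w → Bool) (r : KZ.IntegralRep w)
    (hdom : r.domain = KZ.openOrderedSimplex w)
    (hint : EqOn r.integrand (fun t => ∏ i, KZ.mzvForm (ε i) (t i)) r.domain) :
    KZ.IsToric r := by
  classical
  -- index the strict inequalities by `(Fin w ⊕ Fin w) ⊕ (Fin w × Fin w)`
  refine ⟨Fintype.card ((Fin w ⊕ Fin w) ⊕ (Fin w × Fin w)), 0, w,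
    fun k => Sum.elim (Sum.elim (fun (i : Fin w) (t : Fin w → ℝ) => t i) (fun i t => 1 - t i))
      (fun p t => if p.1 < p.2 then t p.1 - t p.2 else 1)
      ((Fintype.equivFin ((Fin w ⊕ Fin w) ⊕ (Fin w × Fin w))).symm k),
    fun k => Fin.elim0 k,
    fun k t => if ε k then 1 - t k else t k, 1, ?_, ?_, ?_⟩
  · rintro f ((⟨k, rfl⟩ | ⟨k, rfl⟩) | ⟨k, rfl⟩)
    · dsimp only
      generalize (Fintype.equivFin ((Fin w ⊕ Fin w) ⊕ (Fin w × Fin w))).symm k = j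
      rcases j with (i | i) | p
      · exact isSignedBinomial_coord i
      · exact isSignedBinomial_one_sub_coord i
      · by_cases hp : p.1 < p.2
        · simp only [Sum.elim_inr, if_pos hp]
          exact isSignedBinomial_coord_sub_coord p.1 p.2
        · simp only [Sum.elim_inr, if_neg hp]
          exact isSignedBinomial_one
    · exact k.elim0
    · by_cases hk : ε k
      · simp only [hk, if_true]
        exact isSignedBinomial_one_sub_coord k
      · simp only [hk, Bool.false_eq_true, if_false]
        exact isSignedBinomial_coord k
  · rw [hdom]
    ext t
    simp only [KZ.openOrderedSimplex, mem_setOf_eq]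
    constructor
    · rintro ⟨h0, h1, hanti⟩
      refine ⟨fun k => ?_, fun k => k.elim0⟩
      generalize (Fintype.equivFin ((Fin w ⊕ Fin w) ⊕ (Fin w × Fin w))).symm k = j
      rcases j with (i | i) | p
      · exact h0 i
      · exact sub_pos.mpr (h1 i)
      · simp only [Sum.elim_inr]
        split_ifs with hp
        · exact sub_pos.mpr (hanti hp)
        · exact one_pos
    · rintro ⟨hg, -⟩
      refine ⟨fun i => ?_, fun i => ?_, fun i j hij => ?_⟩
      · have h := hg (Fintype.equivFin ((Fin w ⊕ Fin w) ⊕ (Fin w × Fin w)) (Sum.inl (Sum.inl i)))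
        rwa [Equiv.symm_apply_apply] at h
      · have h := hg (Fintype.equivFin ((Fin w ⊕ Fin w) ⊕ (Fin w × Fin w)) (Sum.inl (Sum.inr i)))
        rw [Equiv.symm_apply_apply] at h
        exact sub_pos.mp h
      · have h := hg (Fintype.equivFin ((Fin w ⊕ Fin w) ⊕ (Fin w × Fin w)) (Sum.inr (i, j)))
        rw [Equiv.symm_apply_apply] at h
        simp only [Sum.elim_inr, if_pos hij] at h
        exact sub_pos.mp h
  · intro t ht
    rw [hint ht]
    dsimp only
    rw [prod_mzvForm_eq_one_div, map_one]

/-- **`mzvRep s` is toric as data** (`isToric_of_simplex` with the letters of the binary word of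
`s`). [cite: KontsevichZagier2001, §1.1] -/
theorem isToric_mzvRep (s : List ℕ) (hs : MZV.IsAdmissible s)
    (h₁ : IsSemialgebraicFunOn ℚ (KZ.openOrderedSimplex (MZV.weight s)) (KZ.mzvIntegrand s))
    (h₂ : IntegrableOn (KZ.mzvIntegrand s) (KZ.openOrderedSimplex (MZV.weight s)) volume) :
    KZ.IsToric (KZ.mzvRep s hs h₁ h₂) :=
  isToric_of_simplex (fun k => (MZV.binaryWord s).getD k false) _ rfl fun _ _ => rfl

/-! ### The cubical chart as an integer monomial map -/

/-- The unimodular lower-triangular `0/1` matrix `A i j = [j ≤ i]` of the cubical chart has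
determinant `1`. [folklore] -/
theorem det_chartMatrix (w : ℕ) :
    Matrix.det (fun i j : Fin w => if j ≤ i then (1 : ℤ) else 0) = 1 := by
  rw [Matrix.det_of_lowerTriangular _ (fun i j hij => ?_)]
  · simp
  · have hij' : i < j := hij
    simp [not_le.mpr hij']

/-- The monomial map of the chart matrix is the cubical chart `Φ(x)ᵢ = ∏_{j ≤ i} xⱼ`, as a
product of `if`s (`t¹ = t`, `t⁰ = 1`). [folklore] -/
theorem chart_zpow_eq_ite {w : ℕ} (x : Fin w → ℝ) (i : Fin w) :
    ∏ j, x j ^ (if j ≤ i then (1 : ℤ) else 0) = ∏ j, if j ≤ i then x j else 1 :=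
  Finset.prod_congr rfl fun j _ => by split_ifs <;> simp

/-- The product of `if`s is Brown's cubical coordinate `Hyperlog.φc x i = ∏_{j ∈ Iic i} xⱼ`.
[cite: BrownENS2009, §2.2] -/
theorem prod_ite_le_eq_φc {w : ℕ} (x : Fin w → ℝ) (i : Fin w) :
    (∏ j, if j ≤ i then x j else 1) = Hyperlog.φc x i := by
  rw [Hyperlog.φc, ← Finset.prod_filter]
  refine Finset.prod_congr ?_ fun j _ => rfl
  ext j
  simp

/-- **The image of the cube is the simplex**: the monomial map of the chart matrix IS
`Hyperlog.φc`, which carries the open cube onto the open ordered simplex (`Hyperlog.φc_image`).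
[cite: BrownENS2009, §2.2] -/
theorem image_chart (w : ℕ) :
    (fun (x : Fin w → ℝ) (i : Fin w) => ∏ j, x j ^ (if j ≤ i then (1 : ℤ) else 0)) ''
      {x | ∀ i, 0 < x i ∧ x i < 1} = KZ.openOrderedSimplex w := by
  have h : (fun (x : Fin w → ℝ) (i : Fin w) => ∏ j, x j ^ (if j ≤ i then (1 : ℤ) else 0)) =
      Hyperlog.φc :=
    funext fun x => funext fun i => by rw [chart_zpow_eq_ite, prod_ite_le_eq_φc]
  rw [h]
  exact Hyperlog.φc_image

/-- **The toric Jacobian of the cubical chart**: `∏ᵢ Φ(x)ᵢ = (∏ⱼ xⱼ) · ∏ⱼ xⱼ^{w-1-j}`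
(`Φ(x)ᵢ = xᵢ · ∏_{k<i} x_k` and `∏ᵢ ∏_{k<i} x_k = ∏ⱼ xⱼ^{w-1-j}`). [cite: BrownENS2009, §2.2] -/
theorem prod_φc_eq {w : ℕ} (x : Fin w → ℝ) :
    ∏ i, Hyperlog.φc x i = (∏ j, x j) * ∏ j : Fin w, x j ^ (w - 1 - (j : ℕ)) := by
  rw [← InverseLandau.SimplexValue.prod_prod_Iio_eq_prod_pow, ← Finset.prod_mul_distrib]
  exact Finset.prod_congr rfl fun i _ => Hyperlog.φc_eq_mul x i

/-- The toric Jacobian factor `|det A| · (∏ᵢ ∏ⱼ xⱼ ^ A i j) / ∏ⱼ xⱼ` of the chart matrix is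
`∏ⱼ xⱼ^{w-1-j}` at every point with non-zero coordinates. [cite: BrownENS2009, §2.2] -/
theorem jacobian_chart {w : ℕ} (x : Fin w → ℝ) (hx : ∀ i, x i ≠ 0) :
    |((Matrix.det (fun i j : Fin w => if j ≤ i then (1 : ℤ) else 0) : ℤ) : ℝ)| *
        (∏ i, ∏ j, x j ^ (if j ≤ i then (1 : ℤ) else 0)) / ∏ j, x j =
      ∏ j : Fin w, x j ^ (w - 1 - (j : ℕ)) := by
  have hx0 : ∏ j, x j ≠ 0 := Finset.prod_ne_zero_iff.mpr fun j _ => hx j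
  rw [det_chartMatrix, Int.cast_one, abs_one, one_mul,
    Finset.prod_congr rfl fun i _ => (chart_zpow_eq_ite x i).trans (prod_ite_le_eq_φc x i),
    prod_φc_eq, mul_div_cancel_left₀ _ hx0]

/-! ### The item -/

/-- **`CubicalCoordinates` over the Literature constants**: for admissible `s` and a cube
representation `r` with the cubical integrand, `[mzvRep s] − [r] ∈ KZ.toricRelations` — the
negative of the monomial-move generator `[r] − [mzvRep s]` along the chart matrix `A i j = [j ≤ i]`
(`det A = 1`, cube inside the open positive orthant, image the ordered simplex by `image_chart`,
Jacobian factor `∏ⱼ xⱼ^{w-1-j}` by `jacobian_chart`), both representations being toric as data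
(`isToric_of_cube`, `isToric_mzvRep`). [cite: KontsevichZagier2001, §1.2 rule (2)] -/
theorem mzvRep_sub_cube_mem_toricRelations (s : List ℕ) (hs : MZV.IsAdmissible s)
    (r : KZ.IntegralRep (MZV.weight s)) (hdom : r.domain = {x | ∀ i, 0 < x i ∧ x i < 1})
    (hint : EqOn r.integrand (fun x => KZ.mzvIntegrand s (fun i => ∏ j, if j ≤ i then x j else 1) *
      ∏ j : Fin (MZV.weight s), x j ^ (MZV.weight s - 1 - (j : ℕ))) r.domain) :
    KZ.of (KZ.mzvRep s hs (KZ.mzvIntegrand_isSemialgebraicFunOn_holds s)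
        (KZ.mzvIntegrand_integrableOn_holds s hs)) - KZ.of r ∈ KZ.toricRelations := by
  have hpos : ∀ x ∈ r.domain, ∀ i, 0 < x i := fun x hx i => by
    rw [hdom] at hx
    exact (hx i).1
  have key : KZ.of r - KZ.of (KZ.mzvRep s hs (KZ.mzvIntegrand_isSemialgebraicFunOn_holds s)
      (KZ.mzvIntegrand_integrableOn_holds s hs)) ∈ KZ.toricRelations := by
    refine KZ.sub_mem_toricRelations_of_monomial
      (KZ.of_mem_toricSpan
        (isToric_of_cube (fun k => (MZV.binaryWord s).getD k false) r hdom hint))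
      (KZ.of_mem_toricSpan (isToric_mzvRep s hs _ _))
      (fun i j : Fin (MZV.weight s) => if j ≤ i then (1 : ℤ) else 0)
      (by rw [det_chartMatrix]; exact one_ne_zero) hpos ?_ ?_
    · -- the image of the cube is the simplex
      show KZ.openOrderedSimplex (MZV.weight s) = _
      rw [hdom, image_chart]
    · -- the integrand identity with the toric Jacobian factor
      intro x hx
      show r.integrand x = KZ.mzvIntegrand s _ * _
      rw [jacobian_chart x fun i => (hpos x hx i).ne', hint hx]
      simp only [chart_zpow_eq_ite]
  have hneg := KZ.toricRelations.neg_mem key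
  rwa [neg_sub] at hneg

/-- **`CubicalCoordinates`** (route ToricCore, stmt-KontsevichZagierPeriods-7839): the simplex
representation `mzvRep s` is toric-equivalent to its cubical form — for admissible `s` of weight
`w` and any representation `r` on the open cube `□ʷ` with integrand
`mzvIntegrand s (x₀, x₀x₁, …, x₀⋯x_{w−1}) · ∏ⱼ xⱼ^{w−1−j}` there, `[mzvRep s] − [r] ∈ R_tor`: ONE
monomial change of variables (the cubical chart, `A i j = [j ≤ i]`, `det A = 1`, image of `□ʷ` the
open ordered simplex, Jacobian `∏ⱼ xⱼ^{w−1−j}`), both representations being toric as data. The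
route's inline `let T; let R` are token for token `KZ.toricSpan`, `KZ.toricRelations`, so this is
`mzvRep_sub_cube_mem_toricRelations`. [cite: KontsevichZagier2001, §1.2 rule (2)] -/
theorem cubicalCoordinates_proof :
    Summit.KontsevichZagierPeriods.KontsevichZagierPeriods.Theses.ToricCore.CubicalCoordinates :=
  mzvRep_sub_cube_mem_toricRelations

end Summit.KontsevichZagierPeriods.ToricCore
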